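import Summits.QuantumFields.YangMills.Theorems.UnitScaleTiltProp7Chart47T3Defs
import HarnessLib

/-!
# Route `UnitScaleTilt`, crux K1 child «MinimiserStabilityRegPr» (stmt-QuantumFields-19200), skeleton v10 stub EX, route (α), cut (S3)(i), node (AVG-SYM) —
# DEFINITIONS FILE: **THE COMPLEXIFIED SYMMETRIC BLOCK AVERAGE** (OWNER RULING g25-№3 §3(b), DECISION 02:42:41Z «OPTION A: complexify the symmetric average»):
# [Balaban1987RG1] (0.4) `Ū(c) = exp[Σ_x L^{−d} Σ_{Γ,Γ′} |G|⁻² log U(Γ ∪ [x,x′] ∪ (−Γ′) ∪ (−c))]·U(c)` WRITTEN FOR `(M₂(ℂ))ˣ`-VALUED FIELDS WITHOUT THE SMALL-FIELD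
# CUTOFF (the same exp-mean-`mlog` formula as the route's `BlockAveraging.blockAvg ℰp` ∕ `ExpMeanLog.ESU` on its guard), its `k`-fold iterate and descent
# `descendToGL` (the `(M₂)ˣ`-twin of `T3TiltDescent.descendTo`), and **THE ONE-STEP AGREEMENT ON SMALL `SU(2)` DATA** — the carrier on which the re-aimed
# CHART-47-T³-sym (`B11Prop3Model` at the symmetric remainder `CmapSym(U₀)`, complex-analytic as print's (51) «configurations … with values in the complexified Lie
# algebra 𝔤ᶜ») will be typed

Cell `ym3-torus` ∕ width seat `ym-ust-19200-w1` (gen 2).  YM₃ on T³ is ladder rung R3, not the Clay problem; nothing here is a claim about the crux or the gap.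

WHY.  RULING g25-№3 (★w5-20520 g0 LOCATED): the route's fibre is the SYMMETRIC (0.4) average (`descendTo` = `Averaging.iter (blockAvg ℰp)` ∘ `fieldShift`) while every
lit-balaban [B7]∕[B11] chart letter (`avgIter`, `Cmap`, `prop3_concrete` — hence `Prop7ChartT3.Chart47T3`, p598189, «CHART-47-T³-comb») is the COMB average.  Print's
Prop. 3 scheme (`B11Prop3Model.Dfix`, `B13Contraction113.QuadAnalytic`) is over COMPLEX Banach spaces (Cauchy estimate (53)–(54)); the route's `blockAvg ℰp` is an
inhabitant of `Averaging P j G` for `G = SU(2)` only (`LoopAverage SU(2)`, guarded by `deltaSU`; `GaugeGroup` axioms `dist1_inv`∕`dist1_conj`∕`reTr_le_one` exclude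
`(M₂)ˣ`).  So the complexified average is written as a BESPOKE total map on `(M₂(ℂ))ˣ`-valued fields — loop variables by the group-generic torus holonomy
`B10Eq27TorusAxialLog.holT` along the SAME loop words `BlockAveraging.loopWord` from the SAME block centres `emb`, the mean of `mlog`s exponentiated (`B7Prop1Explicit.expUnit`),
times the straight transporter — and PROVED to agree with the route's average on `SU(2)` fields whose loop variables lie in the guard (where `ESU = eml`,
`ExpMeanLog.coe_ESU_of_small`).

WHAT IS DEFINED (`P : Params`, level `j`; `𝕄 := Matrix (Fin 2) (Fin 2) ℂ`): `loopHolGL U c i` (the loop variable of (0.4) for `U : GaugeField P j (Matrix (Fin 2) (Fin 2) ℂ)ˣ`), `straightGL U c` (the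
straight transporter `U(c)`), `meanLogGL U c` (the exponent `Σ … log …`), **`avgFunGL U : GaugeField P (j+1) (Matrix (Fin 2) (Fin 2) ℂ)ˣ`** (= `expUnit (meanLogGL U c) · straightGL U c`), **`iterGL k`**,
**`descendToGL F n K h`**.  PROVED: unfoldings; `holT_unitsField_toUField` (holonomies commute with `SU(2) → (Matrix (Fin 2) (Fin 2) ℂ)ˣ`); ★ **`unitsField_toUField_avgFun_of_small`** — ONE STEP OF THE
ROUTE'S AVERAGE IS THE COMPLEXIFIED ONE on `SU(2)` fields with all loop variables `‖U(loop) − 1‖ < δ_SU(2)`; `iterGL_succ`, `descendToGL` unfolding.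

HONEST SCOPE.  Definitions + bookkeeping; no estimate.  NOT here: the `k`-step agreement (needs the loop-smallness at every level — `IterPlaqSmall` currency), the symmetric
remainder `CmapSym(U₀)` and its (44)^sym∕(72)^sym∕analyticity `Inputs` (node (AVG-SYM-44∕72∕an)), the junction (AVG-SYM-J) with the real-side `descendTo` through members
(★w3-20520 g2).  Count-neutral toward stmt-QuantumFields-19200 (`--supports`); nothing continuum ∕ OS ∕ mass-gap ∕ Clay.

References: T. Bałaban, CMP **109** (1987) 249–301 [Balaban1987RG1] ((0.4)–(0.7) p.253); CMP **102** (1985) 277–309 [Balaban1985Variational] ((44)–(51) pp.285–286, Prop. 3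
p.289); CMP **98** (1985) 17–51 [Balaban1985Averaging] ((8)–(9) pp.18–19, (19) p.21).
-/

noncomputable section

open scoped Matrix.Norms.L2Operator

namespace Summit.QuantumFields.YangMills.Theorems.Prop7SymAvgGL

open NormedSpace
open Literature.MathematicalPhysics.QuantumFieldTheory.Balaban1983to89
open T3ContinuumYM3Torus
open T4Continuum BlockAveraging
open B7Prop1Explicit (expUnit val_expUnit)
open B10Eq27TorusAxialLog (holT holT_eq_holAt holT_toUField val_holT_unitsField unitsField toUField val_unitsField)
open T3LevelShift (fieldShift)
open ExpMeanLog (ESU eml meanLog eml_eq_exp eml_eq_exp_meanLog coe_ESU_of_small deltaSU expMeanLogSU)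

variable {P : Params} {j : ℕ}

/-! ## §1 The complexified one-step average -/

/-- **THE LOOP VARIABLE `U(Γ ∪ [x,x′] ∪ (−Γ′) ∪ (−c))` OF (0.4) FOR A `(M₂)ˣ`-VALUED FIELD** (index `i = (r, σ, σ′)`: site offset and the two staircase orderings; the group-generic
torus holonomy `holT` along `BlockAveraging.loopWord` from the block centre `emb c₋` — letter for letter `BlockAveraging.loopHol` with `holAt ∘ walk` replaced by `holT`).
[cite: Balaban1987RG1, (0.4) p.253] -/
def loopHolGL (U : GaugeField P j (Matrix (Fin 2) (Fin 2) ℂ)ˣ) (c : PBond P (j + 1)) (i : Idx P) : (Matrix (Fin 2) (Fin 2) ℂ)ˣ :=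
  holT U (emb c.src) (loopWord P.L c.dir (off i.1) i.2.1 i.2.2)

/-- **THE STRAIGHT TRANSPORTER `U(c)`** along the `L` bonds of the coarse bond `c` from `emb c₋` (`AveragingRT.axialAvg` in `holT` form).
[cite: Balaban1987RG1, (0.4) p.253; Balaban1985Averaging, (9) p.19] -/
def straightGL (U : GaugeField P j (Matrix (Fin 2) (Fin 2) ℂ)ˣ) (c : PBond P (j + 1)) : (Matrix (Fin 2) (Fin 2) ℂ)ˣ :=
  holT U (emb c.src) (List.replicate P.L (c.dir, true))

/-- **THE EXPONENT OF (0.4)**: the mean of the logarithm SERIES of the loop variables, `|I|⁻¹ Σ_i log U(loop_i)` (`ExpMeanLog.meanLog`; no cutoff, no guard — the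
complex-analytic continuation of the printed operation off the small-field domain is by the series itself). [cite: Balaban1987RG1, (0.4) p.253] -/
def meanLogGL (U : GaugeField P j (Matrix (Fin 2) (Fin 2) ℂ)ˣ) (c : PBond P (j + 1)) : Matrix (Fin 2) (Fin 2) ℂ :=
  meanLog fun i : Idx P => (loopHolGL U c i : Matrix (Fin 2) (Fin 2) ℂ)

/-- **THE COMPLEXIFIED SYMMETRIC ONE-STEP AVERAGE `Ū(c) = exp[|I|⁻¹ Σ_i log U(loop_i)]·U(c)`** on `(M₂(ℂ))ˣ`-valued fields (the exponential as a unit, `B7Prop1Explicit.expUnit`).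
[cite: Balaban1987RG1, (0.4) p.253] -/
def avgFunGL (U : GaugeField P j (Matrix (Fin 2) (Fin 2) ℂ)ˣ) : GaugeField P (j + 1) (Matrix (Fin 2) (Fin 2) ℂ)ˣ :=
  fun c => expUnit (meanLogGL U c) * straightGL U c

/-- **THE `k`-FOLD COMPLEXIFIED AVERAGE** `Ū^{(k)}` (`Averaging.iter` shape). [cite: Balaban1987RG1, (0.4)+(0.11) p.253] -/
def iterGL : (k : ℕ) → GaugeField P 0 (Matrix (Fin 2) (Fin 2) ℂ)ˣ → GaugeField P k (Matrix (Fin 2) (Fin 2) ℂ)ˣ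
  | 0 => id
  | k + 1 => avgFunGL ∘ iterGL k

/-- **THE COMPLEXIFIED DESCENT `D_{n,K}`** of a T³ member: `K − n` complexified averaging steps on the `K`-th lattice, re-indexed onto the `n`-th member's finest lattice (the
`(M₂)ˣ`-twin of `T3TiltDescent.descendTo`, same `fieldShift`). [cite: Balaban1987RG1, (0.4) p.253; Balaban1985UV3, (1)–(3) p.256] -/
def descendToGL (F : T3Family) (n K : ℕ) (h : n ≤ K) (U : GaugeField (F.P K) 0 (Matrix (Fin 2) (Fin 2) ℂ)ˣ) : GaugeField (F.P n) 0 (Matrix (Fin 2) (Fin 2) ℂ)ˣ :=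
  fieldShift (F.sitesPerDir_eq (m := F.m) (K := n) (j := 0) (m' := F.m) (K' := K) (j' := K - n) (by omega)) (iterGL (K - n) U)

/-! ## §2 Unfoldings -/

/-- `avgFunGL` bondwise. [cite: Balaban1987RG1, (0.4) p.253] -/
theorem avgFunGL_apply (U : GaugeField P j (Matrix (Fin 2) (Fin 2) ℂ)ˣ) (c : PBond P (j + 1)) : avgFunGL U c = expUnit (meanLogGL U c) * straightGL U c := rfl

/-- Its matrix value: `exp(meanLog) · U(c)`. [cite: Balaban1987RG1, (0.4) p.253] -/
theorem val_avgFunGL (U : GaugeField P j (Matrix (Fin 2) (Fin 2) ℂ)ˣ) (c : PBond P (j + 1)) :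
    ((avgFunGL U c : (Matrix (Fin 2) (Fin 2) ℂ)ˣ) : Matrix (Fin 2) (Fin 2) ℂ) = exp (meanLogGL U c) * ((straightGL U c : (Matrix (Fin 2) (Fin 2) ℂ)ˣ) : Matrix (Fin 2) (Fin 2) ℂ) := by
  rw [avgFunGL_apply, Units.val_mul, val_expUnit]

/-- `iterGL 0 = id`. [folklore] -/
theorem iterGL_zero (U : GaugeField P 0 (Matrix (Fin 2) (Fin 2) ℂ)ˣ) : iterGL 0 U = U := rfl

/-- `iterGL (k+1) = avgFunGL ∘ iterGL k`. [folklore] -/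
theorem iterGL_succ (k : ℕ) (U : GaugeField P 0 (Matrix (Fin 2) (Fin 2) ℂ)ˣ) : iterGL (k + 1) U = avgFunGL (iterGL k U) := rfl

/-! ## §3 Agreement with the route's average on small `SU(2)` data (one step) -/

/-- Holonomies commute with the inclusion `SU(2) → (M₂)ˣ` (`unitsField ∘ toUField`), as matrices. [cite: Balaban1985Averaging, (8)–(9) pp.18–19, (19) p.21] -/
theorem val_holT_unitsField_toUField (U : GaugeField P j (Matrix.specialUnitaryGroup (Fin 2) ℂ)) (x : Site P j) (w : List (Letter P.d)) :
    ((holT (unitsField (toUField U)) x w : (Matrix (Fin 2) (Fin 2) ℂ)ˣ) : Matrix (Fin 2) (Fin 2) ℂ) = ((holT U x w : Matrix.specialUnitaryGroup (Fin 2) ℂ) : Matrix (Fin 2) (Fin 2) ℂ) := by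
  rw [val_holT_unitsField, holT_toUField]
  rfl

/-- The loop variables of the inclusion are the inclusions of the route's loop variables `BlockAveraging.loopHol`. [cite: Balaban1987RG1, (0.4) p.253] -/
theorem val_loopHolGL_unitsField_toUField (U : GaugeField P j (Matrix.specialUnitaryGroup (Fin 2) ℂ)) (c : PBond P (j + 1)) (i : Idx P) :
    ((loopHolGL (unitsField (toUField U)) c i : (Matrix (Fin 2) (Fin 2) ℂ)ˣ) : Matrix (Fin 2) (Fin 2) ℂ) = ((loopHol U c i : Matrix.specialUnitaryGroup (Fin 2) ℂ) : Matrix (Fin 2) (Fin 2) ℂ) := by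
  rw [loopHolGL, val_holT_unitsField_toUField, loopHol, holT_eq_holAt]

/-- The straight transporter of the inclusion is the inclusion of `AveragingRT.axialAvg`. [cite: Balaban1987RG1, (0.4) p.253] -/
theorem val_straightGL_unitsField_toUField (U : GaugeField P j (Matrix.specialUnitaryGroup (Fin 2) ℂ)) (c : PBond P (j + 1)) :
    ((straightGL (unitsField (toUField U)) c : (Matrix (Fin 2) (Fin 2) ℂ)ˣ) : Matrix (Fin 2) (Fin 2) ℂ) = ((AveragingRT.axialAvg U c : Matrix.specialUnitaryGroup (Fin 2) ℂ) : Matrix (Fin 2) (Fin 2) ℂ) := by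
  rw [straightGL, val_holT_unitsField_toUField, axialAvg_eq_holAt_walk, holT_eq_holAt]

/-- `eml` is invariant under re-indexing the family along ANY equivalence of index types (the mean of logs is). [folklore] -/
theorem eml_comp_equiv' {ι κ : Type*} [Fintype ι] [Fintype κ] (W : ι → Matrix (Fin 2) (Fin 2) ℂ) (e : κ ≃ ι) : eml (W ∘ e) = eml W := by
  rw [eml_eq_exp, eml_eq_exp, Fintype.card_congr e]
  congr 2
  exact Fintype.sum_equiv e (fun k => MatrixLog.mlog (W (e k))) (fun i => MatrixLog.mlog (W i)) fun _ => rfl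

/-- ★ **ONE STEP OF THE ROUTE'S (0.4) AVERAGE IS THE COMPLEXIFIED ONE ON SMALL `SU(2)` DATA**: if every loop variable of `U` at level `j` is within `δ_{SU(2)}` of `1`, then
`(unitsField ∘ toUField) (blockAvg ℰp U) = avgFunGL ((unitsField ∘ toUField) U)` — on the guard the route's correction factor is `ℰp`'s `ESU = eml = exp ∘ meanLog`
(`coe_ESU_of_small`) of the same loop variables, and the bond variable is the same straight transporter. [cite: Balaban1987RG1, (0.4) p.253] -/
theorem unitsField_toUField_avgFun_of_small (U : GaugeField P j (Matrix.specialUnitaryGroup (Fin 2) ℂ))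
    (hsmall : ∀ (c : PBond P (j + 1)) (i : Idx P), ‖((loopHol U c i : Matrix.specialUnitaryGroup (Fin 2) ℂ) : Matrix (Fin 2) (Fin 2) ℂ) - 1‖ < deltaSU (Fin 2)) :
    unitsField (toUField (avgFun T3UnitLawDensityEML.ℰp U)) = avgFunGL (unitsField (toUField U)) := by
  funext c
  apply Units.ext
  rw [val_unitsField, val_avgFunGL]
  -- the route's side: `corr · axialAvg` with `corr = ℰp.avg (loopHol U c)` on the guard
  have hS : Small T3UnitLawDensityEML.ℰp U c := fun i => hsmall c i
  have hcorr : corr T3UnitLawDensityEML.ℰp U c = T3UnitLawDensityEML.ℰp.avg (loopHol U c) := if_pos hS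
  show ((toUField (avgFun T3UnitLawDensityEML.ℰp U) c : Matrix.unitaryGroup (Fin 2) ℂ) : Matrix (Fin 2) (Fin 2) ℂ) = _
  rw [show ((toUField (avgFun T3UnitLawDensityEML.ℰp U) c : Matrix.unitaryGroup (Fin 2) ℂ) : Matrix (Fin 2) (Fin 2) ℂ) =
      ((avgFun T3UnitLawDensityEML.ℰp U c : Matrix.specialUnitaryGroup (Fin 2) ℂ) : Matrix (Fin 2) (Fin 2) ℂ) from rfl]
  rw [show avgFun T3UnitLawDensityEML.ℰp U c = corr T3UnitLawDensityEML.ℰp U c * AveragingRT.axialAvg U c from rfl, hcorr]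
  rw [Submonoid.coe_mul, val_straightGL_unitsField_toUField]
  congr 1
  -- `ℰp.avg W = ESU (W ∘ enum⁻¹)` and on the guard `ESU = eml`, re-indexing invariant
  show ((ESU (loopHol U c ∘ (LoopAverage.enum (Idx P)).symm) : Matrix.specialUnitaryGroup (Fin 2) ℂ) : Matrix (Fin 2) (Fin 2) ℂ) = exp (meanLogGL (unitsField (toUField U)) c)
  rw [coe_ESU_of_small (W := loopHol U c ∘ (LoopAverage.enum (Idx P)).symm) (fun k => hsmall c _)]
  rw [show (fun k => ((((loopHol U c ∘ (LoopAverage.enum (Idx P)).symm) k : Matrix.specialUnitaryGroup (Fin 2) ℂ)) : Matrix (Fin 2) (Fin 2) ℂ)) =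
      (fun i => ((loopHol U c i : Matrix.specialUnitaryGroup (Fin 2) ℂ) : Matrix (Fin 2) (Fin 2) ℂ)) ∘ (LoopAverage.enum (Idx P)).symm from rfl]
  rw [eml_comp_equiv', eml_eq_exp_meanLog, meanLogGL]
  congr 2
  funext i
  rw [val_loopHolGL_unitsField_toUField]

/-! ## §4 The `k`-step agreement and the descent, on data small at every level -/

/-- **`k` STEPS OF THE ROUTE'S (0.4) AVERAGE ARE THE COMPLEXIFIED ONES** on `SU(2)` data whose loop variables are within `δ_{SU(2)}` of `1` at every level `s < k`
(the route's iterate `Averaging.iter (blockAvg ℰp)`; induction with §3). [cite: Balaban1987RG1, (0.4)+(0.11) p.253] -/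
theorem unitsField_toUField_iter_of_small (U : GaugeField P 0 (Matrix.specialUnitaryGroup (Fin 2) ℂ)) :
    ∀ k : ℕ, (∀ s, s < k → ∀ (c : PBond P (s + 1)) (i : Idx P),
        ‖((loopHol (Averaging.iter (fun l => blockAvg (P := P) (j := l) T3UnitLawDensityEML.ℰp) s U) c i : Matrix.specialUnitaryGroup (Fin 2) ℂ) : Matrix (Fin 2) (Fin 2) ℂ) - 1‖
          < deltaSU (Fin 2)) →
      unitsField (toUField (Averaging.iter (fun l => blockAvg (P := P) (j := l) T3UnitLawDensityEML.ℰp) k U)) = iterGL k (unitsField (toUField U))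
  | 0, _ => rfl
  | k + 1, h => by
    have ih := unitsField_toUField_iter_of_small U k fun s hs => h s (Nat.lt_succ_of_lt hs)
    show unitsField (toUField ((blockAvg (P := P) (j := k) T3UnitLawDensityEML.ℰp).avg
        (Averaging.iter (fun l => blockAvg (P := P) (j := l) T3UnitLawDensityEML.ℰp) k U))) =
      avgFunGL (iterGL k (unitsField (toUField U)))
    rw [blockAvg_avg, unitsField_toUField_avgFun_of_small _ (h k (Nat.lt_succ_self k)), ih]

/-- `fieldShift` (re-indexing along a modulus equality) commutes with the inclusion `SU(2) → (M₂)ˣ`. [cite: Balaban1987RG1, (0.1) p.251] -/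
theorem fieldShift_unitsField_toUField (F : T3Family) {m K j m' K' j' : ℕ} (h : (F.PP m K).sitesPerDir j = (F.PP m' K').sitesPerDir j')
    (V : GaugeField (F.PP m' K') j' (Matrix.specialUnitaryGroup (Fin 2) ℂ)) :
    fieldShift h (unitsField (toUField V)) = unitsField (toUField (fieldShift h V)) := rfl

/-- **THE ROUTE'S DESCENT IS THE COMPLEXIFIED DESCENT** on `SU(2)` data small at every level `s < K − n`: `(unitsField ∘ toUField) (descendTo F ℰp n K h U) =
descendToGL F n K h ((unitsField ∘ toUField) U)`. [cite: Balaban1987RG1, (0.4) p.253; Balaban1985UV3, (1)–(3) p.256] -/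
theorem unitsField_toUField_descendTo_of_small (F : T3Family) {n K : ℕ} (h : n ≤ K) (U : GaugeField (F.P K) 0 (Matrix.specialUnitaryGroup (Fin 2) ℂ))
    (hsmall : ∀ s, s < K - n → ∀ (c : PBond (F.P K) (s + 1)) (i : Idx (F.P K)),
        ‖((loopHol (Averaging.iter (fun l => blockAvg (P := F.P K) (j := l) T3UnitLawDensityEML.ℰp) s U) c i : Matrix.specialUnitaryGroup (Fin 2) ℂ) : Matrix (Fin 2) (Fin 2) ℂ) - 1‖
          < deltaSU (Fin 2)) :
    unitsField (toUField (T3TiltDescent.descendTo F T3UnitLawDensityEML.ℰp n K h U)) = descendToGL F n K h (unitsField (toUField U)) := by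
  exact congrArg (fieldShift (G := (Matrix (Fin 2) (Fin 2) ℂ)ˣ)
      (F.sitesPerDir_eq (m := F.m) (K := n) (j := 0) (m' := F.m) (K' := K) (j' := K - n) (by omega)))
    (unitsField_toUField_iter_of_small U (K - n) hsmall)

end Summit.QuantumFields.YangMills.Theorems.Prop7SymAvgGL

end
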